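import Summits.BirchSwinnertonDyer.BirchSwinnertonDyer.Theorems.UniversalToricDescentSigmaCongruenceAtThreeIffInvariantPair
import Summits.BirchSwinnertonDyer.BirchSwinnertonDyer.Theorems.UniversalToricDescentDefectTransportModThreePTOfLambdaLe
import Summits.BirchSwinnertonDyer.BirchSwinnertonDyer.Theorems.UniversalToricDescentDeepLayerRigidity
import Summits.BirchSwinnertonDyer.BirchSwinnertonDyer.Theorems.UniversalToricDescentDefectTransportModThreePTOfSigmaCongruence
import Mathlib.NumberTheory.DirichletCharacter.Basic
import HarnessLib

/-!
# NODE `gauss-extraction` on crux A = `SigmaCongruenceAtThree` (stmt-BirchSwinnertonDyer-27120, route UTD, rank 201)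

Crux-ideate STANDING COVER, generation 5 (seat `cruxidea-stmt-BirchSwinnertonDyer-27120-1`, 2026-08-30).  Output = this
compiling workfile (0 `sorry`, no new axioms, banned options absent) + the crux idea card `Ideas/gauss-extraction.md`.

## 0. What this generation adds (technique: elementary `3`-adic analysis in `R₀⟦T⟧` + a typed value interface)

g3's node `NodeOneDeepLayer` moved A to the Heegner currency: A ⟸ C^ρ (`DeepNormRatioAtThree`: ONE real ratio between
the deep-layer values of the two Σ-depleted frames), C^ρ ⟸ HL1_E ∧ HL1_{E′} ∧ HL2 ∧ HL3, with HL3 PROVED and HL2 («the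
Gauss-normalised χ-twisted Σ-depleted Heegner-log sums of `E`, `E′` have equal valuation at deep conductor `3ⁿ`») left as an
UNTYPED research leaf whose engine — the "Amice precision gain" of its §(iii) — was described in measure language.
THIS node isolates that engine as an ELEMENTARY LEMMA about `UnrSeries.HasValueAt` at the torsion translates `ζ^u − 1`
and PROVES it (§1), and types the exact value-shape the Heegner side must deliver (§2, `SquareClass`), with the chain
`C^□ := DeepSquareClassAtThree ⟹ C^ρ ⟹ A` kernel-checked BY NAME modulo `hB` (§4; §3 reproduces g3's decider because
Cruxes workfiles are not importable modules on the farm).  After this node, HL2 is no longer a leaf: it is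
GE (PROVED) ∧ GAIN (PROVED) ∧ KLW0 ∧ ST ∧ NONDEG, each of the last three a PRINT statement (tags in §5).

## 1. Pieces and tags (D-0171)

* GE `GaussExtraction p` — support — **PROVED** (`gaussExtraction`): for `n ≥ 1`, `χ` PRIMITIVE mod `pⁿ`, `ζ` a primitive
  `pⁿ`-th root of unity in `ℂ_p`, `Φ ∈ R₀⟦T⟧`: `‖Σ_{u∈(ℤ/pⁿ)ˣ} χ(u)·Φ(ζ^u − 1)‖ ≤ ‖𝔤_ζ(χ)‖` (`= p^{−n/2}`).  Ingredients,
  all PROVED here: `charSum_eq_zero_of_isPrimitive` (primitivity ⟹ orthogonality to additive characters of level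
  `p^{n−1}`, via `DirichletCharacter.factorsThrough_iff_ker_unitsMap`), `charSum_unit_twist` (`Σ χ(u)ζ^{ju} = χ̄(j)𝔤`),
  `norm_charSum_pow_le`, `norm_twistedMoment_le` (`‖Σ_u χ(u)(ζ^u−1)^k‖ ≤ ‖𝔤‖` for every `k`, binomial expansion +
  ultrametric), then the `tsum` swap.  Multi-disc form `norm_sum_discs_le`; congruence form `twistedCongruenceGain`
  (GAIN: if the disc expansions of `E` and `E′` differ by `π·(R₀⟦T⟧-series)` then the weighted twisted sums differ by
  `≤ ‖π‖·‖𝔤‖` — ONE DIGIT BELOW the Gauss sum, at every conductor).  WEAKER than A (it is a theorem).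
* `SquareClass X Y` / C^□ `DeepSquareClassAtThree` — crux-side value interface — **UNDECIDED**; implies C^ρ
  (`deepNormRatio_of_deepSquareClass`, PROVED: `‖q − q′‖ < ‖q′‖ ⟹ ‖q‖ = ‖q′‖`, the common factor cancels), hence A modulo
  `hB` (`sigmaCongruenceAtThree_of_deepSquareClass`) and the PARENT (`defectTransportModThreePT_of_deepSquareClass`, via
  B″ p698423); conversely A ⟹ C^□ (`deepSquareClass_of_sigmaCongruenceAtThree`, PROVED: equal profiles give the shape with
  `c_X = c_Y = 1, r = ‖vY‖, q = q′ = 1`), so C^□ is EQUIV to A modulo `hB` (`deepSquareClass_iff_sigmaCongruenceAtThree`) —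
  an EQUIV node WITH children (the leaves of §2–§3).  NOT a costume: its three clauses are
  literally (HL1_E), (HL1_{E′}) and (HL2 ∧ NONDEG) below, i.e. it is the conjunction the Heegner side produces, stated
  without any CM vocabulary.
* `NormRatio` / C^ρ `DeepNormRatioAtThree` — g3's piece VERBATIM (same telescope, same tail) — EQUIV to A mod `hB` (g3).
* HL3 decider `profile_eq_of_forall_layer_ratio`, `sigmaCongruenceAtThree_of_deepNormRatio` — **PROVED** (g3; §3–§4).

## 2. The derivation C^□ ⟸ leaves (informal; every norm statement is at deep layers `n ≥ N₀(E,E′,Σ)`)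

Notation. `χ` runs over anticyclotomic characters of `K` of exact conductor `3ⁿ` (= the points `ζ − 1`, `ζ` primitive of
order `3ⁿ`, up to the fixed shift by the layer of `γ`); `T = {𝔩, 𝔩̄ : ℓ ∣ NN′, ℓ ≠ 3}` (all such `ℓ` SPLIT in `K` by the two
Heegner hypotheses, and the binder `hc` — an element of the decomposition group with `κ = 3^{c_v} ≠ 0` — excludes inert
places anyway).  `X = 𝓛_E·Π_E`, `Y = 𝓛_{E′}·Π_{E′}` with `𝓛` the tree's BDP frame (`IsBDPLFunction`: the SQUARE — squared
Euler factor, `Ω_p^{4n}` — of the square-root `p`-adic `L`-function) and `Π = ∏_{v∈T} P_v(q_v⁻¹(1+T)^{3^{c_v}})` (ONE Euler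
factor per place).  For a `U₃`-null INTEGRAL `3`-adic modular form `g` of weight `2` and tame level `M′` put
`St_g(χ) := Σ_{σ∈Pic 𝒪_{3ⁿ}} χ(σ)·(θ⁻¹g)(x_σ)` (CM points of conductor `3ⁿ` on the ordinary locus) and `q_g(χ) := St_g(χ)/𝔤(χ)`.
* (ST, print) Serre–Tate + Deuring + CFT: the `φ(3ⁿ)` CM points of conductor `3ⁿ` above the ordinary reduction of `x_𝔞`
  (`𝔞 ∈ Pic 𝒪_K`) are the points `t = ζ^u`, `u ∈ (ℤ/3ⁿ)ˣ`, of its residue disc (a lift with parameter `q` has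
  `End = {α : q^{α_𝔭−α_𝔭̄} = 1} = ℤ₃ + 3ⁿ𝒪_{K,3}` iff `q` is a PRIMITIVE `3ⁿ`-th root of unity), permuted by
  `Gal(H_{3ⁿ}/H) ≅ (𝒪_K/3ⁿ)ˣ/(ℤ/3ⁿ)ˣ ≅ (ℤ/3ⁿ)ˣ` through `u`; `χ|_{Gal(H_{3ⁿ}/H)}` is a Dirichlet character mod `3ⁿ`,
  PRIMITIVE iff `cond χ = 3ⁿ`.  With Katz's expansion principle (`θ⁻¹g` restricted to the disc lies in `W⟦t−1⟧ = R₀⟦T⟧`):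
  `St_g(χ) = Σ_𝔞 χ(σ_𝔞)⁻¹ · Σ_u χ(u)·Φ_{g,𝔞}(ζ^u − 1)` — EXACTLY the shape of `norm_sum_discs_le`.  Hence (GE):
  `‖q_g(χ)‖ ≤ 1` for every integral `g`.  [Katz 1981 Serre–Tate local moduli; Gross 1986; Katz 1976 Ch. V]
* (KLW0, print METHOD = Kriz–Li 2019 Thm. 3.9's proof) `f_E ∈ M₂(Γ₀(27M₀)) ⊂ V(M′, ℤ₃)` IS a `3`-adic modular form of
  tame level `M′` (level `Γ₁(27)`-structure is trivialised on the Igusa tower), `U₃ f_E = 0` (additive), and the Σ3-depletions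
  satisfy `f_E^{[Σ3]} ≡ f_{E′}^{[Σ3]} (mod 3)` coefficientwise (`E[3] ≅ E′[3]`); `θ⁻¹` is integral on `U₃`-null forms
  (Serre–Katz), so `θ⁻¹f_E^{[Σ3]} − θ⁻¹f_{E′}^{[Σ3]} = 3·θ⁻¹h` with `h` integral.  By GAIN: `‖q_E(χ) − q_{E′}(χ)‖ ≤ ‖3‖`
  where `q_E := q_{f_E^{[Σ3]}}`, `q_{E′} := q_{f_{E′}^{[Σ3]}}`.  [Kriz–Li 2019 §3; Katz 1976; Serre 1973]
* (HL1, p-adic Waldspurger in NORM form) `‖X(χ)‖ = ‖c_E‖·‖q_E(χ)‖²`, `‖Y(χ)‖ = ‖c_{E′}‖·‖q_{E′}(χ)‖²` with `χ`-FREE non-zero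
  constants.  Bookkeeping behind it: (i) `𝓛(χ) = c·(𝔢(χ)·CMsum(χ))²` with `‖𝔢(χ)‖ = ‖𝔤(χ)‖⁻¹` — for `E′` this is print
  (BDP 2013 Thm 5.13, Castella–Hsieh 2018 Thm 4.9); for `E` (27 ∣ N) it is the research leaf HL1_E, but note that `𝓛_E` is
  UNIQUELY determined by `IsBDPLFunction` (Strassmann: the interpolation points `u^m − 1` accumulate in `‖T‖ ≤ 1/3`) and
  that the local factor at the split prime for `cond χ_𝔭 ≫ cond π_{E,3}` is the STABLE `ε`-factor `ε(χ_𝔭)²·ω`-twist,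
  independent of `π_{E,3}` (Jacquet–Shalika 1985, "highly ramified ε-factors") — this is why the wild prime is invisible at
  deep layers and why NO unit hypothesis on any period is needed (the constants are READ by HL3, never evaluated);
  (ii) depletions: at PRIMITIVE `χ` of conductor `3ⁿ` the `3`-depletion is free (`St_{g^{[3]}}(χ) = St_g(χ)`: the
  `V₃`-terms are sums over conductor `3^{n−1}` classes and die by the orthogonality `charSum_eq_zero_of_isPrimitive`), and
  the Σ-depletion multiplies `St` by ONE Euler factor per split pair, `St_{g^{[ℓ]}}(χ) = P_{𝔩̄}(χ)·St_g(χ)`, while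
  `‖P_𝔩(χ)‖ = ‖P_{𝔩̄}(χ)‖` EXACTLY (the two series `P(q⁻¹(1+T)^{±e})` take Galois-conjugate values at `ζ − 1`, coefficients in
  `ℤ₃`); so `‖St_{f^{[Σ3]}}(χ)‖² = ‖CMsum(χ)‖²·‖Π(χ)‖` and `‖X(χ)‖ = ‖𝓛_E(χ)‖·‖Π_E(χ)‖ = ‖c_E‖·‖q_E(χ)‖²`.  ✓ consistent with
  `λ(X) = λ(𝓛_E) + Σ_v 3^{c_v}d_v` (`normProfile_sigma`).
* (NONDEG, print for the NON-additive twin) `‖q_{E′}(χ)‖ > ‖3‖` at deep layers: `μ = 0` for the Gauss-normalised CM measure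
  of `θ⁻¹f_{E′}^{[Σ3]}` (Hsieh 2014 Thm. B/C; Vatsal 2003; Cornut–Vatsal) together with `μ(Y) = 0` (binder `hi′`) and HL1_{E′}
  gives `‖q_{E′}(χ)‖ → 1`.  Only the TWIN's non-degeneracy is needed (`norm_eq_of_norm_sub_lt` uses `‖q′‖` only): every wild
  burden sits in HL1_E.
Assembly: `r := 1`, `q := q_E(χ)`, `q′ := q_{E′}(χ)`: HL1 gives the two shapes, KLW0+GE+GAIN give `‖q − q′‖ ≤ ‖3‖`, NONDEG
gives `‖3‖ < ‖q′‖`; this is `SquareClass X Y` at every deep layer, i.e. C^□; then §4.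

## 3. Leaves and tags
* GE, GAIN, DEPL3-core (`sum_eq_zero_of_isPrimitive_of_invariant`), HL3, `C^□ ⟹ C^ρ ⟹ A`, `A ⟹ C^□` — PROVED (this file / g3).
* ST — ATTACKABLE (print; typing needs the Serre–Tate parameter of a CM test object: definition gap D-ST).
* KLW0 — ATTACKABLE as mathematics (print method), IDEA-NEEDED for typing (no `V(M′, R)` / CM-value interface in the tree —
  the same gap g3 recorded), INSTRUMENTABLE (compute `q_E(χ), q_{E′}(χ)` for one O6 pair at `n = 1, 2`).
* HL1_{E′} — ATTACKABLE (print).  * NONDEG — ATTACKABLE (print, twin side only).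
* HL1_E — UNDECIDED research leaf (beyond print at `27 ∣ N`), sharpened here to a NORM identity at DEEP RAMIFIED `χ` only,
  with the stable-`ε` remark; BARRIER-adjacent: `AnomalousHeegnerLogWall` does NOT bite (no unit hypothesis on `c_E`, `c_{E′}`),
  `TraceZeroHeegnerTowerAtAdditiveSplitP` does NOT bite (no norm-compatible tower is used: each layer is read separately;
  the trace-zero phenomenon is exactly the orthogonality that makes the `3`-depletion free), `EisensteinMuConjecture` n/a
  (`ρ̄` onto), `ReducibleAnticyclotomicAtBadP` n/a.

## 4. KEEP/KILL (gen 5) of the live ideas on 27120 (no instrument / vet output since g4; requests #g2–#g4 unanswered)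
KEEP sqrt-toric-functional (line), one-deep-layer (spine), deep-conductor-stability (↑: p722334 landed), universal-period-pair,
heegner-log-anchor, lambda-scale-blind, rankin-selberg-linearity-transplant.  KILLED AS NEW this gen (reduce to existing):
drift-blind norm descent (= g3 C^ρ), Coleman–Gauss ladder as mechanism (= one-deep-layer (iii)), ramified interpolation
characters (= deep-conductor-stability).  Dead technical lines re-confirmed: algebraic-side detour for `λ(X) ≤ λ(Y)` (wrong
half), mod-`p` non-vanishing alone (gives `μ` not `λ`), shallow points, JL / Čerednik–Drinfeld / level raising at 3
(`NoAdmissiblePrimesAtThree`), visibility of the Heegner divisor (= Kriz–Li), trace-zero tower packaging.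

## 5. Why novel (one sentence)
No predecessor isolated a Lean-attackable piece of HL2: the Gauss-normalisation engine is here an elementary theorem about
`R₀⟦T⟧`-values at `ζ^u − 1` (no CM points, measures, Igusa tower or weight-`k` theory), which turns HL2 from a research
leaf into GE(proved) ∧ GAIN(proved) ∧ three print statements, shows that the `3`-depletion is free and the Σ-depletion
norm-exact at primitive deep characters, and localises the entire wild difficulty of A in the single norm identity HL1_E.

References: Kriz–Li 2019 (Forum Math. Sigma) Thm 3.9, Rem 3.10; Bertolini–Darmon–Prasanna 2013 Thm 5.13; Castella–Hsieh
2018 Thm 4.9; Hsieh 2014 (Documenta) Thm B, C; Vatsal 2003; Katz 1976 (Ann. Math. 104) Ch. V, Katz 1981 (Serre–Tate local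
moduli, LNM 868); Gross 1986; Serre 1973 (LNM 350); Jacquet–Shalika 1985 (Math. Ann. 271); Greenberg–Vatsal 2000 Thm (1.5);
Washington GTM 83 §7.
-/

noncomputable section

open scoped Classical

set_option linter.dupNamespace false
set_option autoImplicit false

namespace Summit.BirchSwinnertonDyer.BirchSwinnertonDyer.Cruxes.SigmaCongruenceAtThree.GaussExtraction

open NumberField IsDedekindDomain
open Literature.NumberTheory.EllipticCurves Literature.NumberTheory.EllipticCurves.GreenbergVatsal2000
  Summit.BirchSwinnertonDyer.Rank1Residual.X11b
  Summit.BirchSwinnertonDyer.BirchSwinnertonDyer.Theorems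
  Summit.BirchSwinnertonDyer.BirchSwinnertonDyer.Theorems.UniversalToricDescentNormProfile
  Summit.BirchSwinnertonDyer.BirchSwinnertonDyer.Theorems.UniversalToricDescentAcEulerFactor
  Summit.BirchSwinnertonDyer.BirchSwinnertonDyer.Theorems.UniversalToricDescentDeepLayerRigidity
  Summit.BirchSwinnertonDyer.BirchSwinnertonDyer.Theorems.UniversalToricDescentSigmaCongruenceInvariantPair
  Summit.BirchSwinnertonDyer.BirchSwinnertonDyer.Theorems.UniversalToricDescentDefectTransportModThreePTOfLambdaLe
  Summit.BirchSwinnertonDyer.BirchSwinnertonDyer.Theorems.UniversalToricDescentDefectTransportModThreePTOfSigmaCongruence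
  Summit.BirchSwinnertonDyer.BirchSwinnertonDyer.Theses.UniversalToricDescent

/-! ## §1 Gauss-sum extraction in `R₀⟦T⟧` (PROVED, generic prime `p`) -/

section Generic

variable {p : ℕ} [hp : Fact p.Prime]

/-- The character sum `Σ_{u ∈ (ℤ/pⁿ)ˣ} χ(u)·ξ^{u}` of a mod-`pⁿ` Dirichlet character against the additive character
`u ↦ ξ^u` (`ξ` a `pⁿ`-th root of unity in `ℂ_p`); for `ξ = ζ` primitive this is the Gauss sum `𝔤_ζ(χ)`. [folklore] -/
def charSum (n : ℕ) (χ : DirichletCharacter ℂ_[p] (p ^ n)) (ξ : ℂ_[p]) : ℂ_[p] :=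
  ∑ u : (ZMod (p ^ n))ˣ, χ (u : ZMod (p ^ n)) * ξ ^ (u : ZMod (p ^ n)).val

/-- Values of a Dirichlet character at units have norm `1` in `ℂ_p` (they are roots of unity). [folklore] -/
theorem norm_apply_unit {m : ℕ} [NeZero m] (χ : DirichletCharacter ℂ_[p] m) (u : (ZMod m)ˣ) :
    ‖χ (u : ZMod m)‖ = 1 := by
  have h : (χ (u : ZMod m)) ^ Fintype.card (ZMod m)ˣ = 1 := by
    rw [← map_pow, ← Units.val_pow_eq_pow_val, pow_card_eq_one, Units.val_one, map_one]
  have h' : ‖χ (u : ZMod m)‖ ^ Fintype.card (ZMod m)ˣ = 1 := by rw [← norm_pow, h, norm_one]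
  exact (pow_eq_one_iff_of_nonneg (norm_nonneg _) Fintype.card_ne_zero).mp h'

/-- `ξ^a = ξ^b` when `ξ^m = 1` and `a ≡ b (mod m)`. [folklore] -/
theorem pow_eq_pow_of_pow_eq_one {ξ : ℂ_[p]} {m a b : ℕ} (hξ : ξ ^ m = 1) (h : a % m = b % m) :
    ξ ^ a = ξ ^ b := by
  rw [← Nat.div_add_mod a m, ← Nat.div_add_mod b m, pow_add, pow_add, pow_mul, pow_mul, hξ, one_pow,
    one_pow, one_mul, one_mul, h]

/-- **Unit twist**: `Σ_u χ(u) ζ^{ju} = χ(j)⁻¹ · 𝔤_ζ(χ)` for a unit `j`. [folklore] -/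
theorem charSum_unit_twist {n : ℕ} (χ : DirichletCharacter ℂ_[p] (p ^ n)) {ζ : ℂ_[p]}
    (hζ : ζ ^ (p ^ n) = 1) (J : (ZMod (p ^ n))ˣ) :
    charSum n χ (ζ ^ (J : ZMod (p ^ n)).val) =
      χ ((J⁻¹ : (ZMod (p ^ n))ˣ) : ZMod (p ^ n)) * charSum n χ ζ := by
  haveI : NeZero (p ^ n) := ⟨pow_ne_zero _ hp.out.ne_zero⟩
  unfold charSum
  have key : ∀ u : (ZMod (p ^ n))ˣ, (ζ ^ (J : ZMod (p ^ n)).val) ^ (u : ZMod (p ^ n)).val =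
      ζ ^ ((J * u : (ZMod (p ^ n))ˣ) : ZMod (p ^ n)).val := by
    intro u
    rw [← pow_mul]
    apply pow_eq_pow_of_pow_eq_one hζ
    rw [Units.val_mul, ZMod.val_mul, Nat.mod_mod]
  have hχ : ∀ u : (ZMod (p ^ n))ˣ, χ (u : ZMod (p ^ n)) =
      χ ((J⁻¹ : (ZMod (p ^ n))ˣ) : ZMod (p ^ n)) * χ ((J * u : (ZMod (p ^ n))ˣ) : ZMod (p ^ n)) := by
    intro u
    rw [← map_mul, ← Units.val_mul, ← mul_assoc, inv_mul_cancel, one_mul]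
  calc ∑ u : (ZMod (p ^ n))ˣ, χ (u : ZMod (p ^ n)) * (ζ ^ (J : ZMod (p ^ n)).val) ^ (u : ZMod (p ^ n)).val
      = ∑ u : (ZMod (p ^ n))ˣ, χ ((J⁻¹ : (ZMod (p ^ n))ˣ) : ZMod (p ^ n)) *
          (χ ((J * u : (ZMod (p ^ n))ˣ) : ZMod (p ^ n)) * ζ ^ ((J * u : (ZMod (p ^ n))ˣ) : ZMod (p ^ n)).val) :=
        Finset.sum_congr rfl fun u _ ↦ by rw [key u, hχ u, mul_assoc]
    _ = χ ((J⁻¹ : (ZMod (p ^ n))ˣ) : ZMod (p ^ n)) *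
          ∑ u : (ZMod (p ^ n))ˣ, χ ((J * u : (ZMod (p ^ n))ˣ) : ZMod (p ^ n)) *
            ζ ^ ((J * u : (ZMod (p ^ n))ˣ) : ZMod (p ^ n)).val := by rw [Finset.mul_sum]
    _ = χ ((J⁻¹ : (ZMod (p ^ n))ˣ) : ZMod (p ^ n)) *
          ∑ u : (ZMod (p ^ n))ˣ, χ (u : ZMod (p ^ n)) * ζ ^ (u : ZMod (p ^ n)).val := by
        congr 1
        exact Fintype.sum_equiv (Equiv.mulLeft J) _ _ fun u ↦ rfl

/-- **Orthogonality from primitivity (general form).** A PRIMITIVE character mod `pⁿ` (`n ≥ 1`) is orthogonal to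
every function on `(ℤ/pⁿ)ˣ` that is invariant under the units `≡ 1 (mod p^{n−1})`: `Σ_u χ(u)·F(u) = 0`.  This is the
combinatorial core of two leaves: `charSum_eq_zero_of_isPrimitive` below (GE), and DEPL3 («at primitive conductor-`3ⁿ`
characters the `3`-depletion of the CM sum is free»: the `V₃`-shifted terms are functions of the conductor-`3^{n−1}` class,
i.e. invariant under `Gal(H_{3ⁿ}/H_{3^{n−1}}) ≅ ker((ℤ/3ⁿ)ˣ → (ℤ/3^{n−1})ˣ)`). [cite: Lang GTM 121, Ch. 3 §1 Thm. 1.1] -/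
theorem sum_eq_zero_of_isPrimitive_of_invariant {n : ℕ} (hn : 0 < n) (χ : DirichletCharacter ℂ_[p] (p ^ n))
    (hχ : χ.IsPrimitive) (F : (ZMod (p ^ n))ˣ → ℂ_[p])
    (hF : ∀ u w : (ZMod (p ^ n))ˣ, ZMod.unitsMap (pow_dvd_pow p (Nat.sub_le n 1)) w = 1 → F (u * w) = F u) :
    ∑ u : (ZMod (p ^ n))ˣ, χ (u : ZMod (p ^ n)) * F u = 0 := by
  haveI : NeZero (p ^ n) := ⟨pow_ne_zero _ hp.out.ne_zero⟩
  have hd : p ^ (n - 1) ∣ p ^ n := pow_dvd_pow p (Nat.sub_le n 1)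
  -- a primitive character does not factor through level `p^{n-1}`
  have hnot : ¬ χ.FactorsThrough (p ^ (n - 1)) := by
    intro hf
    have hle : χ.conductor ≤ p ^ (n - 1) :=
      Nat.sInf_le ((DirichletCharacter.mem_conductorSet_iff χ).mpr hf)
    have hc : χ.conductor = p ^ n := hχ
    rw [hc] at hle
    exact absurd hle (not_le.mpr (Nat.pow_lt_pow_right hp.out.one_lt (Nat.sub_lt hn one_pos)))
  rw [DirichletCharacter.factorsThrough_iff_ker_unitsMap hd] at hnot
  -- hence some `w ≡ 1 (mod p^{n-1})` has `χ(w) ≠ 1`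
  obtain ⟨w, hw1, hw2⟩ : ∃ w : (ZMod (p ^ n))ˣ, ZMod.unitsMap hd w = 1 ∧ χ (w : ZMod (p ^ n)) ≠ 1 := by
    by_contra hall
    push Not at hall
    exact hnot fun w hw ↦ by
      rw [MonoidHom.mem_ker] at hw ⊢
      exact Units.ext (by rw [MulChar.coe_toUnitHom, Units.val_one]; exact hall w hw)
  have hre : ∑ u : (ZMod (p ^ n))ˣ, χ (u : ZMod (p ^ n)) * F u =
      χ (w : ZMod (p ^ n)) * ∑ u : (ZMod (p ^ n))ˣ, χ (u : ZMod (p ^ n)) * F u := by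
    rw [Finset.mul_sum]
    have hreidx : ∑ u : (ZMod (p ^ n))ˣ, χ ((u * w : (ZMod (p ^ n))ˣ) : ZMod (p ^ n)) * F (u * w) =
        ∑ u : (ZMod (p ^ n))ˣ, χ (u : ZMod (p ^ n)) * F u :=
      Fintype.sum_equiv (Equiv.mulRight w) _ _ fun u ↦ rfl
    rw [← hreidx]
    refine Finset.sum_congr rfl fun u _ ↦ ?_
    rw [hF u w hw1, Units.val_mul, map_mul]
    ring
  have h0 : (1 - χ (w : ZMod (p ^ n))) * ∑ u : (ZMod (p ^ n))ˣ, χ (u : ZMod (p ^ n)) * F u = 0 := by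
    rw [sub_mul, one_mul, ← hre, sub_self]
  rcases mul_eq_zero.mp h0 with h | h
  · exact absurd (sub_eq_zero.mp h).symm hw2
  · exact h

/-- **Orthogonality from primitivity** (additive characters): a PRIMITIVE character mod `pⁿ` (`n ≥ 1`) is orthogonal to
every additive character of level `p^{n−1}`: `Σ_u χ(u) ξ^u = 0` whenever `ξ^{p^{n−1}} = 1`. [cite: Lang GTM 121, Ch. 3 §1 Thm. 1.1] -/
theorem charSum_eq_zero_of_isPrimitive {n : ℕ} (hn : 0 < n) (χ : DirichletCharacter ℂ_[p] (p ^ n))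
    (hχ : χ.IsPrimitive) {ξ : ℂ_[p]} (hξ : ξ ^ (p ^ (n - 1)) = 1) : charSum n χ ξ = 0 := by
  haveI : NeZero (p ^ n) := ⟨pow_ne_zero _ hp.out.ne_zero⟩
  have hd : p ^ (n - 1) ∣ p ^ n := pow_dvd_pow p (Nat.sub_le n 1)
  refine sum_eq_zero_of_isPrimitive_of_invariant hn χ hχ (fun u ↦ ξ ^ (u : ZMod (p ^ n)).val) fun u w hw1 ↦ ?_
  -- `ξ^{(uw)} = ξ^{u}` since `(uw) ≡ u (mod p^{n-1})`
  have h1 : (ZMod.castHom hd (ZMod (p ^ (n - 1)))) ((w : (ZMod (p ^ n))ˣ) : ZMod (p ^ n)) = 1 := by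
    have := congrArg (fun x : (ZMod (p ^ (n - 1)))ˣ ↦ (x : ZMod (p ^ (n - 1)))) hw1
    simpa [ZMod.unitsMap_def] using this
  have h2 : (ZMod.castHom hd (ZMod (p ^ (n - 1)))) ((u * w : (ZMod (p ^ n))ˣ) : ZMod (p ^ n)) =
      (ZMod.castHom hd (ZMod (p ^ (n - 1)))) (u : ZMod (p ^ n)) := by
    rw [Units.val_mul, map_mul, h1, mul_one]
  rw [ZMod.castHom_apply, ZMod.castHom_apply, ZMod.cast_eq_val, ZMod.cast_eq_val] at h2
  exact pow_eq_pow_of_pow_eq_one hξ ((ZMod.natCast_eq_natCast_iff' _ _ _).mp h2)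

/-- **Every `ζ^j`-character sum is bounded by the Gauss sum**: `‖Σ_u χ(u) ζ^{ju}‖ ≤ ‖𝔤_ζ(χ)‖` for all `j ∈ ℕ`
(`= ‖𝔤‖` if `p ∤ j`, `= 0` if `p ∣ j`). [folklore] -/
theorem norm_charSum_pow_le {n : ℕ} (hn : 0 < n) (χ : DirichletCharacter ℂ_[p] (p ^ n))
    (hχ : χ.IsPrimitive) {ζ : ℂ_[p]} (hζ : IsPrimitiveRoot ζ (p ^ n)) (j : ℕ) :
    ‖charSum n χ (ζ ^ j)‖ ≤ ‖charSum n χ ζ‖ := by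
  haveI : NeZero (p ^ n) := ⟨pow_ne_zero _ hp.out.ne_zero⟩
  by_cases hj : p ∣ j
  · obtain ⟨j', rfl⟩ := hj
    obtain ⟨k, rfl⟩ : ∃ k, n = k + 1 := ⟨n - 1, by omega⟩
    have h1 : (ζ ^ (p * j')) ^ (p ^ (k + 1 - 1)) = 1 := by
      rw [← pow_mul, show p * j' * p ^ (k + 1 - 1) = p ^ (k + 1) * j' by
        rw [Nat.add_sub_cancel, pow_succ]; ring, pow_mul, hζ.pow_eq_one, one_pow]
    rw [charSum_eq_zero_of_isPrimitive hn χ hχ h1, norm_zero]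
    exact norm_nonneg _
  · have hcop : Nat.Coprime j (p ^ n) :=
      (((Nat.Prime.coprime_iff_not_dvd hp.out).mpr hj).symm).pow_right n
    set J : (ZMod (p ^ n))ˣ := ZMod.unitOfCoprime j hcop with hJdef
    have hJ : j % p ^ n = (J : ZMod (p ^ n)).val % p ^ n := by
      rw [hJdef, ZMod.coe_unitOfCoprime, ZMod.val_natCast, Nat.mod_mod]
    rw [pow_eq_pow_of_pow_eq_one hζ.pow_eq_one hJ, charSum_unit_twist χ hζ.pow_eq_one J, norm_mul,
      norm_apply_unit, one_mul]

/-- **Twisted moments are bounded by the Gauss sum**: `‖Σ_u χ(u)(ζ^u − 1)^k‖ ≤ ‖𝔤_ζ(χ)‖` for every `k`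
(binomial expansion + `norm_charSum_pow_le` + ultrametric inequality). [folklore] -/
theorem norm_twistedMoment_le {n : ℕ} (hn : 0 < n) (χ : DirichletCharacter ℂ_[p] (p ^ n))
    (hχ : χ.IsPrimitive) {ζ : ℂ_[p]} (hζ : IsPrimitiveRoot ζ (p ^ n)) (k : ℕ) :
    ‖∑ u : (ZMod (p ^ n))ˣ, χ (u : ZMod (p ^ n)) * (ζ ^ (u : ZMod (p ^ n)).val - 1) ^ k‖ ≤
      ‖charSum n χ ζ‖ := by
  have hexp : ∀ u : (ZMod (p ^ n))ˣ, (ζ ^ (u : ZMod (p ^ n)).val - 1) ^ k =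
      ∑ m ∈ Finset.range (k + 1), (-1) ^ (m + k) * (k.choose m : ℂ_[p]) * (ζ ^ m) ^ (u : ZMod (p ^ n)).val := by
    intro u
    rw [sub_pow]
    refine Finset.sum_congr rfl fun m _ ↦ ?_
    rw [one_pow, mul_one, ← pow_mul, mul_comm ((u : ZMod (p ^ n)).val) m, pow_mul]
    ring
  have hswap : ∑ u : (ZMod (p ^ n))ˣ, χ (u : ZMod (p ^ n)) * (ζ ^ (u : ZMod (p ^ n)).val - 1) ^ k =
      ∑ m ∈ Finset.range (k + 1), (-1) ^ (m + k) * (k.choose m : ℂ_[p]) * charSum n χ (ζ ^ m) := by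
    simp_rw [hexp, Finset.mul_sum]
    rw [Finset.sum_comm]
    refine Finset.sum_congr rfl fun m _ ↦ ?_
    unfold charSum
    rw [Finset.mul_sum]
    exact Finset.sum_congr rfl fun u _ ↦ by ring
  rw [hswap]
  refine IsUltrametricDist.norm_sum_le_of_forall_le_of_nonneg (norm_nonneg _) fun m _ ↦ ?_
  calc ‖(-1) ^ (m + k) * (k.choose m : ℂ_[p]) * charSum n χ (ζ ^ m)‖
      = ‖(k.choose m : ℂ_[p])‖ * ‖charSum n χ (ζ ^ m)‖ := by
        rw [norm_mul, norm_mul, norm_pow, norm_neg, norm_one, one_pow, one_mul]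
    _ ≤ 1 * ‖charSum n χ ζ‖ :=
        mul_le_mul (IsUltrametricDist.norm_natCast_le_one ℂ_[p] _) (norm_charSum_pow_le hn χ hχ hζ m)
          (norm_nonneg _) zero_le_one
    _ = ‖charSum n χ ζ‖ := one_mul _

/-- **Piece GE `GaussExtraction` (support; PROVED below as `gaussExtraction`).** «For every `n ≥ 1`, every PRIMITIVE
Dirichlet character `χ` mod `pⁿ` with values in `ℂ_p`, every primitive `pⁿ`-th root of unity `ζ ∈ ℂ_p` and every
`Φ ∈ R₀⟦T⟧`: the `χ`-twisted sum of the values of `Φ` at the torsion translates `ζ^u − 1` (`u ∈ (ℤ/pⁿ)ˣ`) is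
divisible by the Gauss sum: `‖Σ_u χ(u)·Φ(ζ^u − 1)‖ ≤ ‖𝔤_ζ(χ)‖` (`= ‖p‖^{n/2}`).»  This is the AMICE-FREE form of the
normalisation engine of the tower Kriz–Li congruence (one-deep-layer's HL2 / its (iii)): applied to the restriction
`Φ_𝔞 ∈ R₀⟦t−1⟧` of an integral weight-`0` `3`-adic modular function to the ordinary residue disc of a CM point `x_𝔞`
(Serre–Tate parameter `t`; the conductor-`3ⁿ` CM points in the disc are `t = ζ^u`), it says the `χ`-twisted CM sums
are `𝔤(χ)`-divisible with no measure, Igusa tower or weight-`k` vocabulary. [folklore] -/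
def GaussExtraction (p : ℕ) [Fact p.Prime] : Prop :=
  ∀ (n : ℕ), 0 < n → ∀ (χ : DirichletCharacter ℂ_[p] (p ^ n)), χ.IsPrimitive →
    ∀ (ζ : ℂ_[p]), IsPrimitiveRoot ζ (p ^ n) →
    ∀ (Φ : UnrSeries p) (v : (ZMod (p ^ n))ˣ → ℂ_[p]),
      (∀ u : (ZMod (p ^ n))ˣ, Φ.HasValueAt (ζ ^ (u : ZMod (p ^ n)).val - 1) (v u)) →
      ‖∑ u : (ZMod (p ^ n))ˣ, χ (u : ZMod (p ^ n)) * v u‖ ≤ ‖charSum n χ ζ‖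

/-- **GE holds.** Proof: `Σ_u χ(u)Φ(ζ^u−1) = Σ'_k c_k · S_k` with `S_k = Σ_u χ(u)(ζ^u−1)^k`, `‖c_k‖ ≤ 1`
(`R₀`-coefficients) and `‖S_k‖ ≤ ‖𝔤‖` (`norm_twistedMoment_le`); ultrametric `tsum` bound. [folklore] -/
theorem gaussExtraction : GaussExtraction p := by
  intro n hn χ hχ ζ hζ Φ v hv
  have hsum : HasSum (fun k : ℕ ↦ ∑ u : (ZMod (p ^ n))ˣ, χ (u : ZMod (p ^ n)) *
      ((((PowerSeries.coeff k Φ : unrIntegers p)) : ℂ_[p]) * (ζ ^ (u : ZMod (p ^ n)).val - 1) ^ k))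
      (∑ u : (ZMod (p ^ n))ˣ, χ (u : ZMod (p ^ n)) * v u) :=
    hasSum_sum fun u _ ↦ (hv u).mul_left (χ (u : ZMod (p ^ n)))
  rw [← hsum.tsum_eq]
  refine IsUltrametricDist.norm_tsum_le_of_forall_le_of_nonneg (norm_nonneg _) fun k ↦ ?_
  have hfac : ∑ u : (ZMod (p ^ n))ˣ, χ (u : ZMod (p ^ n)) *
        ((((PowerSeries.coeff k Φ : unrIntegers p)) : ℂ_[p]) * (ζ ^ (u : ZMod (p ^ n)).val - 1) ^ k) =
      (((PowerSeries.coeff k Φ : unrIntegers p)) : ℂ_[p]) *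
        ∑ u : (ZMod (p ^ n))ˣ, χ (u : ZMod (p ^ n)) * (ζ ^ (u : ZMod (p ^ n)).val - 1) ^ k := by
    rw [Finset.mul_sum]
    exact Finset.sum_congr rfl fun u _ ↦ by ring
  rw [hfac, norm_mul]
  calc ‖(((PowerSeries.coeff k Φ : unrIntegers p)) : ℂ_[p])‖ *
        ‖∑ u : (ZMod (p ^ n))ˣ, χ (u : ZMod (p ^ n)) * (ζ ^ (u : ZMod (p ^ n)).val - 1) ^ k‖
      ≤ 1 * ‖charSum n χ ζ‖ :=
        mul_le_mul (Halves.norm_coe_unrIntegers_le_one p _) (norm_twistedMoment_le hn χ hχ hζ k)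
          (norm_nonneg _) zero_le_one
    _ = ‖charSum n χ ζ‖ := one_mul _

/-- **Multi-disc form** (the shape of a `χ`-twisted CM sum over `Pic(𝒪_{3ⁿ})`: finitely many ordinary residue discs
`a`, each weighted by a number of norm `≤ 1` — the value `χ(σ_𝔞)⁻¹` — and carrying its own `R₀⟦T⟧`-expansion `Φ_a`):
the total twisted sum is still `𝔤`-divisible. [folklore] -/
theorem norm_sum_discs_le {n : ℕ} (hn : 0 < n) (χ : DirichletCharacter ℂ_[p] (p ^ n)) (hχ : χ.IsPrimitive)
    {ζ : ℂ_[p]} (hζ : IsPrimitiveRoot ζ (p ^ n)) {ι : Type} (s : Finset ι) (w : ι → ℂ_[p])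
    (hw : ∀ a ∈ s, ‖w a‖ ≤ 1) (Φ : ι → UnrSeries p) (v : ι → (ZMod (p ^ n))ˣ → ℂ_[p])
    (hv : ∀ a ∈ s, ∀ u : (ZMod (p ^ n))ˣ, (Φ a).HasValueAt (ζ ^ (u : ZMod (p ^ n)).val - 1) (v a u)) :
    ‖∑ a ∈ s, w a * ∑ u : (ZMod (p ^ n))ˣ, χ (u : ZMod (p ^ n)) * v a u‖ ≤ ‖charSum n χ ζ‖ := by
  refine IsUltrametricDist.norm_sum_le_of_forall_le_of_nonneg (norm_nonneg _) fun a ha ↦ ?_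
  rw [norm_mul]
  calc ‖w a‖ * ‖∑ u : (ZMod (p ^ n))ˣ, χ (u : ZMod (p ^ n)) * v a u‖ ≤ 1 * ‖charSum n χ ζ‖ :=
        mul_le_mul (hw a ha) (gaussExtraction n hn χ hχ ζ hζ (Φ a) (v a) (hv a ha)) (norm_nonneg _) zero_le_one
    _ = ‖charSum n χ ζ‖ := one_mul _

/-- **Congruence gain (the typed "Amice precision gain").** If two families of disc expansions have values differing by
`π·(values of R₀⟦T⟧-series Ψ_a)` — e.g. `Φ_a − Φ′_a = 3·Ψ_a` with `Ψ_a` INTEGRAL (Kriz–Li weight `0`: `(f^{[Σ]}_E −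
f^{[Σ3]}_{E′})/3` is an integral `3`-adic modular form, and `θ⁻¹` preserves integrality on `U₃`-killed forms) — then the
weighted `χ`-twisted sums differ by a quantity of norm `≤ ‖π‖·‖𝔤_ζ(χ)‖`, i.e. the GAUSS-NORMALISED sums are still
congruent modulo `π`.  One digit is gained over the raw congruence at every conductor `pⁿ`. [folklore] -/
theorem twistedCongruenceGain {n : ℕ} (hn : 0 < n) (χ : DirichletCharacter ℂ_[p] (p ^ n)) (hχ : χ.IsPrimitive)
    {ζ : ℂ_[p]} (hζ : IsPrimitiveRoot ζ (p ^ n)) {ι : Type} (s : Finset ι) (w : ι → ℂ_[p])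
    (hw : ∀ a ∈ s, ‖w a‖ ≤ 1) (Ψ : ι → UnrSeries p) (v v' d : ι → (ZMod (p ^ n))ˣ → ℂ_[p]) (π : ℂ_[p])
    (hd : ∀ a ∈ s, ∀ u : (ZMod (p ^ n))ˣ, (Ψ a).HasValueAt (ζ ^ (u : ZMod (p ^ n)).val - 1) (d a u))
    (hrel : ∀ a ∈ s, ∀ u : (ZMod (p ^ n))ˣ, v a u - v' a u = π * d a u) :
    ‖∑ a ∈ s, w a * ∑ u : (ZMod (p ^ n))ˣ, χ (u : ZMod (p ^ n)) * v a u -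
        ∑ a ∈ s, w a * ∑ u : (ZMod (p ^ n))ˣ, χ (u : ZMod (p ^ n)) * v' a u‖ ≤ ‖π‖ * ‖charSum n χ ζ‖ := by
  have hdiff : ∑ a ∈ s, w a * ∑ u : (ZMod (p ^ n))ˣ, χ (u : ZMod (p ^ n)) * v a u -
      ∑ a ∈ s, w a * ∑ u : (ZMod (p ^ n))ˣ, χ (u : ZMod (p ^ n)) * v' a u =
      π * ∑ a ∈ s, w a * ∑ u : (ZMod (p ^ n))ˣ, χ (u : ZMod (p ^ n)) * d a u := by
    rw [← Finset.sum_sub_distrib, Finset.mul_sum]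
    refine Finset.sum_congr rfl fun a ha ↦ ?_
    rw [← mul_sub, ← Finset.sum_sub_distrib, Finset.mul_sum, Finset.mul_sum, Finset.mul_sum]
    refine Finset.sum_congr rfl fun u _ ↦ ?_
    rw [← mul_sub, hrel a ha u]
    ring
  rw [hdiff, norm_mul]
  exact mul_le_mul_of_nonneg_left (norm_sum_discs_le hn χ hχ hζ s w hw Ψ d hd) (norm_nonneg _)

end Generic

/-! ## §2 Deep-layer value interfaces at `p = 3` (typed; plumbing PROVED) -/

section AtThree

/-- Ultrametric: `‖q − q′‖ < ‖q′‖ ⟹ ‖q‖ = ‖q′‖`. [folklore] -/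
theorem norm_eq_of_norm_sub_lt {q q' : ℂ_[3]} (h : ‖q - q'‖ < ‖q'‖) : ‖q‖ = ‖q'‖ := by
  have := IsUltrametricDist.norm_add_eq_max_of_norm_ne_norm h.ne
  rwa [sub_add_cancel, max_eq_right h.le] at this

/-- **NormRatio** (pair property of two series `X, Y ∈ R₀⟦T⟧`): «there are ONE real `ρ` and a layer `N₀` such that at
every layer `n ≥ N₀` (`n ≥ 1`), every primitive `3ⁿ`-th root of unity `ζ` and all values, `‖X(ζ−1)‖ = ρ·‖Y(ζ−1)‖`.»
Over A's binders (`DeepValueShapeAtThree NormRatio`) this is VERBATIM g3's C^ρ `OneDeepLayer.DeepNormRatioAtThree`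
(NodeOneDeepLayer.lean, §5). [folklore] -/
def NormRatio (X Y : UnrSeries 3) : Prop :=
  ∃ ρ : ℝ, ∃ N₀ : ℕ, ∀ n : ℕ, N₀ ≤ n → 0 < n → ∀ ζ : ℂ_[3], IsPrimitiveRoot ζ (3 ^ n) → ∀ vX vY : ℂ_[3],
    X.HasValueAt (ζ - 1) vX → Y.HasValueAt (ζ - 1) vY → ‖vX‖ = ρ * ‖vY‖

/-- **SquareClass** (pair property; the HEEGNER CURRENCY): «there are a layer `N₀` and two NON-ZERO `3`-adic constants
`c_X, c_Y` (χ-free period constants of the two `p`-adic Waldspurger formulae — never evaluated, never assumed units)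
such that at every deep layer every pair of values has the shape `‖X(ζ−1)‖ = ‖c_X‖·r·‖q‖²`, `‖Y(ζ−1)‖ = ‖c_Y‖·r·‖q′‖²`
with a COMMON real factor `r ≥ 0` (Gauss sum / `3`-power / the common split-prime local factor / the Σ-bookkeeping
factor, see the module docstring) and two numbers `q, q′` (the Gauss-normalised Σ-stabilised Heegner-log sums of `E`
and `E′` at conductor `3ⁿ`) that are CONGRUENT BELOW THEIR OWN SIZE: `‖q − q′‖ < ‖q′‖`.»  [cite: KrizLi2019, Thm. 3.9,
Rem. 3.10] [cite: LiuZhangZhang2018, Thm. 1.1.1] [cite: BDP2013, Thm. 5.13] -/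
def SquareClass (X Y : UnrSeries 3) : Prop :=
  ∃ (N₀ : ℕ) (cX cY : ℂ_[3]), cX ≠ 0 ∧ cY ≠ 0 ∧ ∀ n : ℕ, N₀ ≤ n → 0 < n → ∀ ζ : ℂ_[3],
    IsPrimitiveRoot ζ (3 ^ n) → ∀ vX vY : ℂ_[3], X.HasValueAt (ζ - 1) vX → Y.HasValueAt (ζ - 1) vY →
      ∃ (r : ℝ) (q q' : ℂ_[3]), ‖vX‖ = ‖cX‖ * r * ‖q‖ ^ 2 ∧ ‖vY‖ = ‖cY‖ * r * ‖q'‖ ^ 2 ∧ ‖q - q'‖ < ‖q'‖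

/-- **SquareClass ⟹ NormRatio** with `ρ = ‖c_X‖/‖c_Y‖` (PROVED): congruence below their own size forces `‖q‖ = ‖q′‖`,
and the common factor cancels. [folklore] -/
theorem normRatio_of_squareClass (X Y : UnrSeries 3) (h : SquareClass X Y) : NormRatio X Y := by
  obtain ⟨N₀, cX, cY, -, hcY, h⟩ := h
  refine ⟨‖cX‖ / ‖cY‖, N₀, fun n hn0 hn ζ hζ vX vY hvX hvY ↦ ?_⟩
  obtain ⟨r, q, q', hX, hY, hqq⟩ := h n hn0 hn ζ hζ vX vY hvX hvY
  rw [hX, hY, norm_eq_of_norm_sub_lt hqq]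
  have hcY' : ‖cY‖ ≠ 0 := norm_ne_zero_iff.mpr hcY
  field_simp

/-- Common SHAPE: A's binders VERBATIM (O6 wild curve `E` with `ρ̄₃` onto and `r_an = 1`, `3`-congruent non-additive
twin `E′`, strict Heegner `K`, anticyclotomic `κ`, generator `γ`, degree-one `𝔭 ∋ 3`, the other slot `𝔭′`, branch
`ι′`, frames `𝓛, 𝓛′` with `μ(𝓛′) = 0`, bad set `T`, exact indices `c_v`) followed by the pair property `S X Y` of the two
Σ-depletions `X = 𝓛·Π_E(3^c)`, `Y = 𝓛′·Π_{E′}(3^c)` (canonical exponents `e_v = 3^{c_v}`).  Same telescope as g3's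
`OneDeepLayer.DeepNormShapeAtThree` / `DeepNormRatioAtThree`. [folklore] -/
def DeepValueShapeAtThree (S : UnrSeries 3 → UnrSeries 3 → Prop) : Prop :=
      ∀ (W : WeierstrassCurve ℚ) [W.IsElliptic] [W.IsGloballyMinimal] (W' : WeierstrassCurve ℚ) [W'.IsElliptic]
      [W'.IsGloballyMinimal] (N N' : ℕ) [NeZero N] [NeZero N'] (K : Type) [Field K] [NumberField K] (Dt :
      Literature.NumberTheory.EllipticCurves.ModularForms.ModularParametrizationData W N) (Dt' :
      Literature.NumberTheory.EllipticCurves.ModularForms.ModularParametrizationData W' N'),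
      Summit.BirchSwinnertonDyer.Rank1Residual.Additive.ClassO6 W 3 → W.HasSurjectiveModNGaloisRep 3 →
      W.analyticRank = 1 → W.conductorNorm ℤ = N → Summit.BirchSwinnertonDyer.Rank1Residual.O6.ModPCongruent W' W
      3 → ¬ Literature.NumberTheory.EllipticCurves.Rank1Residual.Addv W' 3 → W'.conductorNorm ℤ = N' →
      Literature.NumberTheory.EllipticCurves.IsImaginaryQuadratic K →
      Literature.NumberTheory.EllipticCurves.SatisfiesHeegnerHypothesis N K →
      Literature.NumberTheory.EllipticCurves.SatisfiesHeegnerHypothesis N' K → ∀ (κ :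
      Literature.NumberTheory.EllipticCurves.ZpExtension K 3), κ.IsAnticyclotomic → ∀ (γ :
      Field.absoluteGaloisGroup K) [Fact (κ.IsTopGenerator γ)] (𝔭 : IsDedekindDomain.HeightOneSpectrum
      (NumberField.RingOfIntegers K)), ((3 : ℕ) : NumberField.RingOfIntegers K) ∈ 𝔭.asIdeal →
      𝔭.asIdeal.ramificationIdx (NumberField.RingOfIntegers ℚ) = 1 → 𝔭.asIdeal.inertiaDeg
      (NumberField.RingOfIntegers ℚ) = 1 → ∀ (𝔭' : IsDedekindDomain.HeightOneSpectrum (NumberField.RingOfIntegers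
      K)), ((3 : ℕ) : NumberField.RingOfIntegers K) ∈ 𝔭'.asIdeal → 𝔭' ≠ 𝔭 → ∀ (ι' : PadicAlgCl 3 ≃+* ℂ),
      Summit.BirchSwinnertonDyer.BirchSwinnertonDyer.Theorems.SchneiderFree.BranchInducesPrime 3 ι' 𝔭 → ∀ (ΩK : ℂ)
      (Ωp : ℂ_[3]) (L : Literature.NumberTheory.EllipticCurves.UnrSeries 3), ΩK ≠ 0 → Ωp ≠ 0 →
      Literature.NumberTheory.EllipticCurves.IsBDPLFunction ι' 𝔭 κ γ Dt.f ΩK Ωp L → ∀ (ΩK' : ℂ) (Ωp' : ℂ_[3]) (L'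
      : Literature.NumberTheory.EllipticCurves.UnrSeries 3), ΩK' ≠ 0 → Ωp' ≠ 0 →
      Literature.NumberTheory.EllipticCurves.IsBDPLFunction ι' 𝔭 κ γ Dt'.f ΩK' Ωp' L' → (∃ i : ℕ,
      ‖((PowerSeries.coeff i L' : Literature.NumberTheory.EllipticCurves.unrIntegers 3) : ℂ_[3])‖ = 1) → ∀ (T :
      Finset (IsDedekindDomain.HeightOneSpectrum (NumberField.RingOfIntegers K))) (c :
      IsDedekindDomain.HeightOneSpectrum (NumberField.RingOfIntegers K) → ℕ), (↑T = {v :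
      IsDedekindDomain.HeightOneSpectrum (NumberField.RingOfIntegers K) | ((3 : ℕ) : NumberField.RingOfIntegers K)
      ∉ v.asIdeal ∧ (¬ (W.baseChange K).HasGoodReductionAt v ∨ ¬ (W'.baseChange K).HasGoodReductionAt v)}) → (∀ v
      ∈ T, (∃ d₀ : Literature.NumberTheory.EllipticCurves.GreenbergSelmer.decomp (K := K) v, (κ (d₀ :
      Field.absoluteGaloisGroup K)).toAdd = (3 : ℤ_[3]) ^ c v) ∧ (∀ d :
      Literature.NumberTheory.EllipticCurves.GreenbergSelmer.decomp (K := K) v, (3 : ℤ_[3]) ^ c v ∣ (κ (d :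
      Field.absoluteGaloisGroup K)).toAdd)) →
      S (L * PowerSeries.map (Halves.toUnr 3) (∏ v ∈ T, (Polynomial.aeval
          (PowerSeries.C ((Nat.card (IsLocalRing.ResidueField (v.adicCompletionIntegers K)) : ℤ_[3]).inv) *
            PowerSeries.binomialSeries ℤ_[3] ((3 : ℤ_[3]) ^ c v)) ((W.baseChange K).localPolynomialAt v) :
            IwasawaAlgebra 3)))
        (L' * PowerSeries.map (Halves.toUnr 3) (∏ v ∈ T, (Polynomial.aeval
          (PowerSeries.C ((Nat.card (IsLocalRing.ResidueField (v.adicCompletionIntegers K)) : ℤ_[3]).inv) *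
            PowerSeries.binomialSeries ℤ_[3] ((3 : ℤ_[3]) ^ c v)) ((W'.baseChange K).localPolynomialAt v) :
            IwasawaAlgebra 3)))

/-- The shape is monotone in the pair property (PROVED). [folklore] -/
theorem deepValueShape_mono {S S' : UnrSeries 3 → UnrSeries 3 → Prop} (hSS' : ∀ X Y, S X Y → S' X Y)
    (h : DeepValueShapeAtThree S) : DeepValueShapeAtThree S' := by
  unfold DeepValueShapeAtThree at h ⊢
  intro W _ _ W' _ _ N N' _ _ K _ _ Dt Dt' hO6 hsurj hrk hN hmod haddv hN' hK hH hH' κ hκ γ _ 𝔭 h𝔭 hram hdeg 𝔭'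
    h𝔭' hne ι' hι ΩK Ωp L hΩK hΩp hL ΩK' Ωp' L' hΩK' hΩp' hL' hi' T c hT hc
  exact hSS' _ _ (h W W' N N' K Dt Dt' hO6 hsurj hrk hN hmod haddv hN' hK hH hH' κ hκ γ 𝔭 h𝔭 hram hdeg 𝔭' h𝔭' hne
    ι' hι ΩK Ωp L hΩK hΩp hL ΩK' Ωp' L' hΩK' hΩp' hL' hi' T c hT hc)

/-- **C^ρ `DeepNormRatioAtThree`** := the shape with `NormRatio` (tag EQUIV to A modulo `hB` — g3; UNDECIDED). -/
def DeepNormRatioAtThree : Prop := DeepValueShapeAtThree NormRatio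

/-- **C^□ `DeepSquareClassAtThree`** := the shape with `SquareClass` (tag: EQUIV to A modulo `hB` —
`deepSquareClass_iff_sigmaCongruenceAtThree`; UNDECIDED — this is exactly what HL1_E ∧ HL1_E′ ∧ HL2 deliver, see the
module docstring). -/
def DeepSquareClassAtThree : Prop := DeepValueShapeAtThree SquareClass

/-- `C^□ ⟹ C^ρ` (PROVED). -/
theorem deepNormRatio_of_deepSquareClass (h : DeepSquareClassAtThree) : DeepNormRatioAtThree :=
  deepValueShape_mono normRatio_of_squareClass h

end AtThree

/-! ## §3 The HL3 decider chain `C^ρ ⟹ A` (REPRODUCED from g3's `NodeOneDeepLayer.lean` §1–§5, namespace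
`…Cruxes.SigmaCongruenceAtThree.OneDeepLayer`, because Cruxes workfiles are not importable modules on the farm
(`lean check` of an importing scratch file: `remote:stale:…:unbuilt:…NodeOneDeepLayer`); texts verbatim, no novelty
claimed; there the same statements are `exists_hasValueAt`, `norm_value_eq_of_profile`, `normProfile_sigma`,
`totient_three_pow_succ`, `no_two_layers`, `profile_eq_of_forall_layer_ratio`, `sigmaCongruenceAtThree_of_deepNormRatio`.) -/

section Reproduced

variable {p : ℕ} [hp : Fact p.Prime]

/-- Values of `H ∈ R₀⟦T⟧` exist on the open unit disc of `ℂ_p`. [folklore] -/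
theorem exists_hasValueAt (H : UnrSeries p) {x : ℂ_[p]} (hx : ‖x‖ < 1) : ∃ v : ℂ_[p], H.HasValueAt x v := by
  have hs : Summable (fun k : ℕ ↦ ((PowerSeries.coeff k H : unrIntegers p) : ℂ_[p]) * x ^ k) := by
    refine (summable_geometric_of_lt_one (norm_nonneg x) hx).of_norm_bounded (fun k ↦ ?_)
    rw [norm_mul, norm_pow]
    exact mul_le_of_le_one_left (pow_nonneg (norm_nonneg x) k) (Halves.norm_coe_unrIntegers_le_one p _)
  exact ⟨_, hs.hasSum⟩

/-- **The law below `λ`** (g3): profile `m < φ(pⁿ)` ⟹ `‖H(ζ−1)‖ = ‖ζ−1‖^m > p⁻¹`. [cite: Washington1997, §7.1–7.2] -/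
theorem norm_value_eq_of_profile {H : UnrSeries p} {m n : ℕ} (hn : 0 < n)
    (hH : (∀ i < m, ‖((PowerSeries.coeff i H : unrIntegers p) : ℂ_[p])‖ < 1) ∧
      ‖((PowerSeries.coeff m H : unrIntegers p) : ℂ_[p])‖ = 1)
    (hmφ : m < Nat.totient (p ^ n)) {ζ : ℂ_[p]} (hζ : IsPrimitiveRoot ζ (p ^ n)) {v : ℂ_[p]}
    (hv : H.HasValueAt (ζ - 1) v) :
    ‖v‖ = ‖ζ - 1‖ ^ m ∧ (p : ℝ)⁻¹ < ‖ζ - 1‖ ^ m := by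
  obtain ⟨hr0, hr1⟩ := norm_sub_one_pos_lt_one_of_isPrimitiveRoot_prime_pow hn hζ
  have hrφ : ‖ζ - 1‖ ^ Nat.totient (p ^ n) = (p : ℝ)⁻¹ :=
    norm_sub_one_pow_totient_of_isPrimitiveRoot_prime_pow hn hζ
  have hp0 : (0 : ℝ) < (p : ℝ)⁻¹ := by rw [← hrφ]; exact pow_pos hr0 _
  have hrm : (p : ℝ)⁻¹ < ‖ζ - 1‖ ^ m := by rw [← hrφ]; exact pow_lt_pow_right_of_lt_one₀ hr0 hr1 hmφ
  have hlow : ∀ i < m, ‖((PowerSeries.coeff i H : unrIntegers p) : ℂ_[p])‖ ≤ (p : ℝ)⁻¹ := fun i hi ↦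
    R1.norm_le_inv_of_norm_lt_one (PowerSeries.coeff i H).2 (hH.1 i hi)
  have hC0 : (0 : ℝ) ≤ max (p : ℝ)⁻¹ (‖ζ - 1‖ ^ (m + 1)) := le_max_of_le_left hp0.le
  have hdom : ∀ i : ℕ, i ≠ m →
      ‖((PowerSeries.coeff i H : unrIntegers p) : ℂ_[p]) * (ζ - 1) ^ i‖ ≤ max (p : ℝ)⁻¹ (‖ζ - 1‖ ^ (m + 1)) := by
    intro i hi
    rw [norm_mul, norm_pow]
    rcases Nat.lt_or_gt_of_ne hi with him | him
    · refine le_max_of_le_left ?_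
      calc ‖((PowerSeries.coeff i H : unrIntegers p) : ℂ_[p])‖ * ‖ζ - 1‖ ^ i ≤ (p : ℝ)⁻¹ * 1 :=
            mul_le_mul (hlow i him) (pow_le_one₀ hr0.le hr1.le) (pow_nonneg hr0.le i) hp0.le
        _ = (p : ℝ)⁻¹ := mul_one _
    · refine le_max_of_le_right ?_
      calc ‖((PowerSeries.coeff i H : unrIntegers p) : ℂ_[p])‖ * ‖ζ - 1‖ ^ i ≤ 1 * ‖ζ - 1‖ ^ (m + 1) :=
            mul_le_mul (Halves.norm_coe_unrIntegers_le_one p _)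
              (pow_le_pow_of_le_one hr0.le hr1.le (Nat.succ_le_of_lt him)) (pow_nonneg hr0.le i) zero_le_one
        _ = ‖ζ - 1‖ ^ (m + 1) := one_mul _
  have hlt : max (p : ℝ)⁻¹ (‖ζ - 1‖ ^ (m + 1)) <
      ‖((PowerSeries.coeff m H : unrIntegers p) : ℂ_[p]) * (ζ - 1) ^ m‖ := by
    rw [norm_mul, norm_pow, hH.2, one_mul]
    exact max_lt hrm (pow_lt_pow_right_of_lt_one₀ hr0 hr1 (Nat.lt_succ_self m))
  have hnormv := norm_eq_of_hasValueAt_of_dominant hv m hC0 hdom hlt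
  rw [norm_mul, norm_pow, hH.2, one_mul] at hnormv
  exact ⟨hnormv, hrm⟩

/-- **Norm profile of a Σ-depletion** (g3): profile of `L·Π_E(3^c)` is `m + Σ_v 3^{c_v} d_v(E)`.
[cite: GreenbergVatsal2000, §1 display (9)] [cite: LeiMullerXia2023, Lemma 3.5, Cor. 3.8] -/
theorem normProfile_sigma {K : Type} [Field K] [NumberField K] (E : WeierstrassCurve K)
    (T : Finset (HeightOneSpectrum (𝓞 K))) (hT : ∀ v ∈ T, ((3 : ℕ) : 𝓞 K) ∉ v.asIdeal)
    (c : HeightOneSpectrum (𝓞 K) → ℕ) {L : UnrSeries 3} {m : ℕ}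
    (hm : (∀ i < m, ‖((PowerSeries.coeff i L : unrIntegers 3) : ℂ_[3])‖ < 1) ∧
      ‖((PowerSeries.coeff m L : unrIntegers 3) : ℂ_[3])‖ = 1) :
    (∀ i < (m + ∑ v ∈ T, 3 ^ c v * (eulerFactorModP E 3 v).rootMultiplicity
          (((Nat.card (IsLocalRing.ResidueField (v.adicCompletionIntegers K)) : ℕ) : ZMod 3)⁻¹)),
        ‖((PowerSeries.coeff i (L * PowerSeries.map (Halves.toUnr 3) (∏ v ∈ T, (Polynomial.aeval
          (PowerSeries.C ((Nat.card (IsLocalRing.ResidueField (v.adicCompletionIntegers K)) : ℤ_[3]).inv) *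
            PowerSeries.binomialSeries ℤ_[3] ((3 : ℤ_[3]) ^ c v)) (E.localPolynomialAt v) : IwasawaAlgebra 3))) :
          unrIntegers 3) : ℂ_[3])‖ < 1) ∧
      ‖((PowerSeries.coeff (m + ∑ v ∈ T, 3 ^ c v * (eulerFactorModP E 3 v).rootMultiplicity
          (((Nat.card (IsLocalRing.ResidueField (v.adicCompletionIntegers K)) : ℕ) : ZMod 3)⁻¹))
          (L * PowerSeries.map (Halves.toUnr 3) (∏ v ∈ T, (Polynomial.aeval
          (PowerSeries.C ((Nat.card (IsLocalRing.ResidueField (v.adicCompletionIntegers K)) : ℤ_[3]).inv) *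
            PowerSeries.binomialSeries ℤ_[3] ((3 : ℤ_[3]) ^ c v)) (E.localPolynomialAt v) : IwasawaAlgebra 3))) :
          unrIntegers 3) : ℂ_[3])‖ = 1 := by
  haveI : Fact (Nat.Prime 3) := ⟨Nat.prime_three⟩
  have he : ∀ v ∈ T, (3 : ℤ_[3]) ^ c v ≠ 0 := fun v _ ↦ (pow_three_ne_zero_and_valuation (c v)).1
  obtain ⟨-, hord⟩ := order_map_toZMod_prod_aeval_localPolynomialAt E T hT (fun v ↦ (3 : ℤ_[3]) ^ c v) he
  have hP := normProfile_map_toUnr_of_order_eq _ hord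
  have key : ∑ v ∈ T, (eulerFactorModP E 3 v).rootMultiplicity
          (((Nat.card (IsLocalRing.ResidueField (v.adicCompletionIntegers K)) : ℕ) : ZMod 3)⁻¹) *
        3 ^ ((3 : ℤ_[3]) ^ c v).valuation =
      ∑ v ∈ T, 3 ^ c v * (eulerFactorModP E 3 v).rootMultiplicity
          (((Nat.card (IsLocalRing.ResidueField (v.adicCompletionIntegers K)) : ℕ) : ZMod 3)⁻¹) :=
    Finset.sum_congr rfl fun v _ ↦ by rw [(pow_three_ne_zero_and_valuation (c v)).2, mul_comm]
  rw [← key]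
  exact normProfile_mul hm hP

/-- `φ(3ⁿ⁺¹) = 3·φ(3ⁿ)` for `n ≥ 1` (g3). [folklore] -/
theorem totient_three_pow_succ {n : ℕ} (hn : 0 < n) :
    Nat.totient (3 ^ (n + 1)) = 3 * Nat.totient (3 ^ n) := by
  obtain ⟨k, rfl⟩ : ∃ k, n = k + 1 := ⟨n - 1, by omega⟩
  rw [Nat.totient_prime_pow_succ Nat.prime_three, Nat.totient_prime_pow_succ Nat.prime_three, pow_succ]
  ring

/-- Two radii `a, b` with `a^φ = 1/3 = b^{3φ}` cannot have a common positive power (g3). [folklore] -/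
private theorem no_two_layers {a b : ℝ} {φ d : ℕ} (ha0 : 0 ≤ a) (hb0 : 0 ≤ b) (hd : d ≠ 0)
    (haφ : a ^ φ = ((3 : ℕ) : ℝ)⁻¹) (hbφ : b ^ (3 * φ) = ((3 : ℕ) : ℝ)⁻¹) (h : a ^ d = b ^ d) : False := by
  have hab : a = b := (pow_left_inj₀ ha0 hb0 hd).mp h
  subst hab
  rw [mul_comm, pow_mul, haφ] at hbφ
  norm_num at hbφ

/-- **HL3 decider** (g3, PROVED): one real ratio at all deep layers forces `λ(X) = λ(Y)`. [folklore] -/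
theorem profile_eq_of_forall_layer_ratio {X Y : UnrSeries 3} {M M' : ℕ}
    (hX : (∀ i < M, ‖((PowerSeries.coeff i X : unrIntegers 3) : ℂ_[3])‖ < 1) ∧
      ‖((PowerSeries.coeff M X : unrIntegers 3) : ℂ_[3])‖ = 1)
    (hY : (∀ i < M', ‖((PowerSeries.coeff i Y : unrIntegers 3) : ℂ_[3])‖ < 1) ∧
      ‖((PowerSeries.coeff M' Y : unrIntegers 3) : ℂ_[3])‖ = 1)
    {ρ : ℝ} {N₀ : ℕ}
    (h : ∀ n : ℕ, N₀ ≤ n → 0 < n → ∀ ζ : ℂ_[3], IsPrimitiveRoot ζ (3 ^ n) → ∀ vX vY : ℂ_[3],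
      X.HasValueAt (ζ - 1) vX → Y.HasValueAt (ζ - 1) vY → ‖vX‖ = ρ * ‖vY‖) : M = M' := by
  by_contra hne
  set n : ℕ := N₀ + M + M' + 1 with hn
  have hn1 : 0 < n := by omega
  have hn2 : 0 < n + 1 := by omega
  have hφ : Nat.totient (3 ^ n) = 2 * 3 ^ (n - 1) := by
    rw [Nat.totient_prime_pow Nat.prime_three hn1]; ring
  have h3pow : n - 1 < 3 ^ (n - 1) := Nat.lt_pow_self (by norm_num)
  have hMφ : M < Nat.totient (3 ^ n) := by rw [hφ]; omega
  have hM'φ : M' < Nat.totient (3 ^ n) := by rw [hφ]; omega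
  have hφ' : Nat.totient (3 ^ (n + 1)) = 3 * Nat.totient (3 ^ n) := totient_three_pow_succ hn1
  have hMφ' : M < Nat.totient (3 ^ (n + 1)) := by rw [hφ']; omega
  have hM'φ' : M' < Nat.totient (3 ^ (n + 1)) := by rw [hφ']; omega
  haveI : NeZero ((3 : ℕ) : ℂ_[3]) := ⟨by exact_mod_cast (show (3 : ℕ) ≠ 0 by norm_num)⟩
  obtain ⟨ζ, hζ⟩ := HasEnoughRootsOfUnity.prim (M := ℂ_[3]) (n := 3 ^ n)
  obtain ⟨ξ, hξ⟩ := HasEnoughRootsOfUnity.prim (M := ℂ_[3]) (n := 3 ^ (n + 1))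
  obtain ⟨hr0, hr1⟩ := norm_sub_one_pos_lt_one_of_isPrimitiveRoot_prime_pow hn1 hζ
  obtain ⟨hs0, hs1⟩ := norm_sub_one_pos_lt_one_of_isPrimitiveRoot_prime_pow hn2 hξ
  have hrφ : ‖ζ - 1‖ ^ Nat.totient (3 ^ n) = ((3 : ℕ) : ℝ)⁻¹ :=
    norm_sub_one_pow_totient_of_isPrimitiveRoot_prime_pow hn1 hζ
  have hsφ : ‖ξ - 1‖ ^ Nat.totient (3 ^ (n + 1)) = ((3 : ℕ) : ℝ)⁻¹ :=
    norm_sub_one_pow_totient_of_isPrimitiveRoot_prime_pow hn2 hξ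
  rw [hφ'] at hsφ
  obtain ⟨vX, hvX⟩ := exists_hasValueAt X hr1
  obtain ⟨vY, hvY⟩ := exists_hasValueAt Y hr1
  obtain ⟨wX, hwX⟩ := exists_hasValueAt X hs1
  obtain ⟨wY, hwY⟩ := exists_hasValueAt Y hs1
  have h1 := h n (by omega) hn1 ζ hζ vX vY hvX hvY
  have h2 := h (n + 1) (by omega) hn2 ξ hξ wX wY hwX hwY
  rw [(norm_value_eq_of_profile hn1 hX hMφ hζ hvX).1, (norm_value_eq_of_profile hn1 hY hM'φ hζ hvY).1] at h1
  rw [(norm_value_eq_of_profile hn2 hX hMφ' hξ hwX).1, (norm_value_eq_of_profile hn2 hY hM'φ' hξ hwY).1] at h2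
  rcases Nat.lt_or_gt_of_ne hne with hlt | hgt
  · obtain ⟨d, rfl⟩ : ∃ d, M' = M + d := ⟨M' - M, by omega⟩
    have hd : d ≠ 0 := by omega
    rw [pow_add] at h1 h2
    have k1 : ‖ζ - 1‖ ^ M * 1 = ‖ζ - 1‖ ^ M * (ρ * ‖ζ - 1‖ ^ d) := by linear_combination h1
    have k2 : ‖ξ - 1‖ ^ M * 1 = ‖ξ - 1‖ ^ M * (ρ * ‖ξ - 1‖ ^ d) := by linear_combination h2
    have e1 := mul_left_cancel₀ (pow_pos hr0 M).ne' k1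
    have e2 := mul_left_cancel₀ (pow_pos hs0 M).ne' k2
    have hρ : ρ ≠ 0 := by rintro rfl; simp at e1
    have e : ‖ζ - 1‖ ^ d = ‖ξ - 1‖ ^ d := mul_left_cancel₀ hρ (e1.symm.trans e2)
    exact no_two_layers hr0.le hs0.le hd hrφ hsφ e
  · obtain ⟨d, rfl⟩ : ∃ d, M = M' + d := ⟨M - M', by omega⟩
    have hd : d ≠ 0 := by omega
    rw [pow_add] at h1 h2
    have k1 : ‖ζ - 1‖ ^ M' * ‖ζ - 1‖ ^ d = ‖ζ - 1‖ ^ M' * ρ := by linear_combination h1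
    have k2 : ‖ξ - 1‖ ^ M' * ‖ξ - 1‖ ^ d = ‖ξ - 1‖ ^ M' * ρ := by linear_combination h2
    have e1 := mul_left_cancel₀ (pow_pos hr0 M').ne' k1
    have e2 := mul_left_cancel₀ (pow_pos hs0 M').ne' k2
    exact no_two_layers hr0.le hs0.le hd hrφ hsφ (e1.trans e2.symm)

end Reproduced

/-! ## §4 Compositions to A and to the PARENT, BY NAME -/

/-- **C^ρ ⟹ A `SigmaCongruenceAtThree` BY NAME** (modulo `hB`; g3's composition, reproduced).
[cite: GreenbergVatsal2000, Thm. (1.5)] [cite: Hsieh2014, Thm. B] -/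
theorem sigmaCongruenceAtThree_of_deepNormRatio
    (hB : Literature.NumberTheory.EllipticCurves.Hsieh2014.thmB_exists_isHsiehLFunction_coeff_norm_eq_one_unrPeriod_anyLevel)
    (h : DeepNormRatioAtThree) : SigmaCongruenceAtThree := by
  haveI : Fact (Nat.Prime 3) := ⟨Nat.prime_three⟩
  unfold DeepNormRatioAtThree DeepValueShapeAtThree at h
  refine (sigmaCongruenceAtThree_iff_lambdaIdentity_of_thmB hB).mpr ?_
  intro W _ _ W' _ _ N N' _ _ K _ _ Dt Dt' hO6 hsurj hrk hN hmod haddv hN' hK hH hH' κ hκ γ _ 𝔭 h𝔭 hram hdeg 𝔭'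
    h𝔭' hne ι' hι ΩK Ωp L hΩK hΩp hL ΩK' Ωp' L' hΩK' hΩp' hL' hi' T c hT hc m m' hm hm'
  have hT3 := not_mem_of_coe_eq hT
  obtain ⟨ρ, N₀, hρ⟩ := h W W' N N' K Dt Dt' hO6 hsurj hrk hN hmod haddv hN' hK hH hH' κ hκ γ 𝔭 h𝔭 hram hdeg 𝔭'
    h𝔭' hne ι' hι ΩK Ωp L hΩK hΩp hL ΩK' Ωp' L' hΩK' hΩp' hL' hi' T c hT hc
  exact profile_eq_of_forall_layer_ratio (normProfile_sigma (W.baseChange K) T hT3 c hm)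
    (normProfile_sigma (W'.baseChange K) T hT3 c hm') hρ

/-- **C^□ ⟹ A `SigmaCongruenceAtThree` BY NAME** (modulo `hB` = item 27933): the node's `closes`. -/
theorem sigmaCongruenceAtThree_of_deepSquareClass
    (hB : Literature.NumberTheory.EllipticCurves.Hsieh2014.thmB_exists_isHsiehLFunction_coeff_norm_eq_one_unrPeriod_anyLevel)
    (h : DeepSquareClassAtThree) : SigmaCongruenceAtThree :=
  sigmaCongruenceAtThree_of_deepNormRatio hB (deepNormRatio_of_deepSquareClass h)

/-- **C^□ ⟹ the PARENT `DefectTransportModThreePT` BY NAME** (modulo `hB`), via B″ (p698423). -/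
theorem defectTransportModThreePT_of_deepSquareClass
    (hB : Literature.NumberTheory.EllipticCurves.Hsieh2014.thmB_exists_isHsiehLFunction_coeff_norm_eq_one_unrPeriod_anyLevel)
    (h : DeepSquareClassAtThree) : DefectTransportModThreePT :=
  defectTransportModThreePT_of_sigmaCongruenceAtThree (sigmaCongruenceAtThree_of_deepSquareClass hB h)

/-- Equal norm profiles give `SquareClass` with `c_X = c_Y = 1`, `r = ‖vY‖`, `q = q′ = 1` from the layer `λ + 1` on. [folklore] -/
theorem squareClass_of_profile_eq {X Y : UnrSeries 3} {M : ℕ}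
    (hX : (∀ i < M, ‖((PowerSeries.coeff i X : unrIntegers 3) : ℂ_[3])‖ < 1) ∧
      ‖((PowerSeries.coeff M X : unrIntegers 3) : ℂ_[3])‖ = 1)
    (hY : (∀ i < M, ‖((PowerSeries.coeff i Y : unrIntegers 3) : ℂ_[3])‖ < 1) ∧
      ‖((PowerSeries.coeff M Y : unrIntegers 3) : ℂ_[3])‖ = 1) : SquareClass X Y := by
  haveI : Fact (Nat.Prime 3) := ⟨Nat.prime_three⟩
  refine ⟨M + 1, 1, 1, one_ne_zero, one_ne_zero, fun n hn0 hn ζ hζ vX vY hvX hvY ↦ ⟨‖vY‖, 1, 1, ?_, ?_, ?_⟩⟩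
  · have hφ : Nat.totient (3 ^ n) = 2 * 3 ^ (n - 1) := by
      rw [Nat.totient_prime_pow Nat.prime_three hn]; ring
    have h3pow : n - 1 < 3 ^ (n - 1) := Nat.lt_pow_self (by norm_num)
    have hMφ : M < Nat.totient (3 ^ n) := by rw [hφ]; omega
    rw [(norm_value_eq_of_profile hn hX hMφ hζ hvX).1, (norm_value_eq_of_profile hn hY hMφ hζ hvY).1]
    simp
  · simp
  · simp

/-- **A ⟹ C^□ (certifies the tag: C^□ is EQUIVALENT to A modulo `hB`, not merely sufficient).** From A the λ-identity
(p705895); `μ(𝓛) = 0` (self, from `hB`) and `μ(𝓛′) = 0` (binder) give equal profiles of the two Σ-depletions; then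
`squareClass_of_profile_eq`. [cite: GreenbergVatsal2000, Thm. (1.5)] [cite: Hsieh2014, Thm. B] -/
theorem deepSquareClass_of_sigmaCongruenceAtThree
    (hB : Literature.NumberTheory.EllipticCurves.Hsieh2014.thmB_exists_isHsiehLFunction_coeff_norm_eq_one_unrPeriod_anyLevel)
    (hA : SigmaCongruenceAtThree) : DeepSquareClassAtThree := by
  haveI : Fact (Nat.Prime 3) := ⟨Nat.prime_three⟩
  have hΛ := (sigmaCongruenceAtThree_iff_lambdaIdentity_of_thmB hB).mp hA
  unfold DeepSquareClassAtThree DeepValueShapeAtThree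
  intro W _ _ W' _ _ N N' _ _ K _ _ Dt Dt' hO6 hsurj hrk hN hmod haddv hN' hK hH hH' κ hκ γ _ 𝔭 h𝔭 hram hdeg 𝔭'
    h𝔭' hne ι' hι ΩK Ωp L hΩK hΩp hL ΩK' Ωp' L' hΩK' hΩp' hL' hi' T c hT hc
  have hT3 := not_mem_of_coe_eq hT
  obtain ⟨m, hm⟩ := UniversalToricDescentSelfMuZero.exists_normProfile_of_exists_coeff_norm_eq_one
    (UniversalToricDescentSelfMuZero.self_forall_isBDPLFunction_coeff_norm_eq_one hB W N K Dt hO6 hsurj hrk hN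
      hK hH κ hκ γ 𝔭 h𝔭 hram hdeg 𝔭' h𝔭' hne ι' hι ΩK Ωp L hΩK hΩp hL)
  obtain ⟨m', hm'⟩ := UniversalToricDescentSelfMuZero.exists_normProfile_of_exists_coeff_norm_eq_one hi'
  have hXp := normProfile_sigma (W.baseChange K) T hT3 c hm
  have hYp := normProfile_sigma (W'.baseChange K) T hT3 c hm'
  have heq := hΛ W W' N N' K Dt Dt' hO6 hsurj hrk hN hmod haddv hN' hK hH hH' κ hκ γ 𝔭 h𝔭 hram hdeg 𝔭' h𝔭' hne ι'
    hι ΩK Ωp L hΩK hΩp hL ΩK' Ωp' L' hΩK' hΩp' hL' hi' T c hT hc m m' hm hm'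
  rw [heq] at hXp
  exact squareClass_of_profile_eq hXp hYp

/-- **C^□ ⟺ A modulo `hB`.** -/
theorem deepSquareClass_iff_sigmaCongruenceAtThree
    (hB : Literature.NumberTheory.EllipticCurves.Hsieh2014.thmB_exists_isHsiehLFunction_coeff_norm_eq_one_unrPeriod_anyLevel) :
    DeepSquareClassAtThree ↔ SigmaCongruenceAtThree :=
  ⟨sigmaCongruenceAtThree_of_deepSquareClass hB, deepSquareClass_of_sigmaCongruenceAtThree hB⟩

end Summit.BirchSwinnertonDyer.BirchSwinnertonDyer.Cruxes.SigmaCongruenceAtThree.GaussExtraction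

end
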